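import Literature.NumberTheory.EllipticCurves.GreenbergVatsal2000.UnramifiedOutsideFinite
import Literature.NumberTheory.EllipticCurves.Kato2004.UniversalNormsCoeffFramed
import Literature.NumberTheory.EllipticCurves.GreenbergSelmerCofreeTorsionGaloisModule
import Literature.NumberTheory.EllipticCurves.ZpExtension
import HarnessLib

/-!
# The Greenberg–Vatsal classes of `H¹(ℚ_n, A_ρ[p^k])` unramified outside `S₀ ∪ {p}` form a FINITE set
# (Silverman X.4.3 for the finite module `A_ρ[p^k]` at the layers of a `ℤ_p`-extension)

Topic `NumberTheory/EllipticCurves`, namespace `Literature.NumberTheory.EllipticCurves.GreenbergSelmer`.  THEOREMS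
ONLY (no definition, no named fact, no instance, no `sorry`).  Written by a prover seat of the cell `bsd-wall`
(route `ResidualThetaTransportAtTwo`, crux RSL_g stmt-BirchSwinnertonDyer-22608; stub-plan rev 14 Q59, card
`stub-cmlambdalower-k3-g10` item H-E `CofreeLayerUnramifiedFinite`): for a framed representation
`ρ : Γ_ℚ → GL_n(𝒪)`, `𝒪 = padicCoeffIntegers S` COMPACT (e.g. `ℚ_p(S)/ℚ_p` finite), the discrete module
`A_ρ[p^k] = (Cofree ρ F)[p^k]` is finite (`UniversalNorms.finite_cofreeTorsionBy_of_compactSpace`) with continuous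
action (`cofreeTorsionGaloisModule`), so by `GreenbergVatsal2000.finite_setOf_mem_unramifiedOutside` (Silverman
X.4.3 at an open normal level) the set `unramifiedOutside (κ.layerSubgroup m) A_ρ[p^k] p S₀` is FINITE for every
`ℤ_p`-extension `κ`, layer `m`, level `k` and finite `S₀` — the `hfin` input of the Kőnig glue
`CofreeLevelwiseKonig.exists_iwasawaH1_of_levelwise` for every solution set cut out inside it.

* `continuousSMul_cofreeTorsionBy` — the action of `Γ_ℚ` on `A_ρ[N]` is continuous (from `cofreeTorsionGaloisModule`);
* `finite_setOf_mem_unramifiedOutside_cofreeTorsionBy` — the finiteness, `[CompactSpace 𝒪]` form, any OPEN NORMAL `H`;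
* `finite_setOf_mem_unramifiedOutside_cofreeTorsionBy_layer` / `…_of_finiteDimensional` — at `H = κ.layerSubgroup m`.

HONEST FRAMING: bookkeeping; BSD is not proved by any of this.

References: J. H. Silverman, *AEC* (2009), Lemma X.4.3 [SilvermanAEC2009]; R. Greenberg, V. Vatsal, Invent. Math.
142 (2000), §2 pp. 16, 23 [GreenbergVatsal2000]; R. Greenberg, Adv. Stud. Pure Math. 17 (1989), §1 p. 98 [Greenberg1989].
-/

noncomputable section

open scoped NumberField
open Field IsDedekindDomain
open Literature.NumberTheory.GaloisRepresentations
open Literature.NumberTheory.EllipticCurves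
open Literature.NumberTheory.EllipticCurves.Kato2004

namespace Literature.NumberTheory.EllipticCurves.GreenbergSelmer

variable {p : ℕ} [Fact p.Prime] (S : Set (PadicAlgCl p)) {n : ℕ}
  (ρ : FramedGaloisRep ℚ (padicCoeffIntegers S) n)

/-- The action of `Γ_ℚ` on `A_ρ[N]` is (jointly) continuous — the continuity field of the discrete Galois
module `cofreeTorsionGaloisModule S ρ N` (`σ • a`, open stabilisers). [cite: SerreGaloisCohomology1997, I §2.1] -/
theorem continuousSMul_cofreeTorsionBy (N : ℤ) :
    ContinuousSMul (absoluteGaloisGroup ℚ) ↥(AddSubgroup.torsionBy (Cofree ρ (padicCoeffField S)) N) :=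
  ⟨(cofreeTorsionGaloisModule S ρ N).continuous_smul⟩

/-- **`unramifiedOutside H A_ρ[p^k] p S₀` is finite** for `𝒪` compact, `H ⊴ Γ_ℚ` OPEN and `S₀` finite (Silverman
X.4.3 at level `H` for the finite module `A_ρ[p^k]`: `GreenbergVatsal2000.finite_setOf_mem_unramifiedOutside`).
[cite: SilvermanAEC2009, Lemma X.4.3] [cite: GreenbergVatsal2000, §2 pp. 16, 23] -/
theorem finite_setOf_mem_unramifiedOutside_cofreeTorsionBy [CompactSpace (padicCoeffIntegers S)]
    (H : Subgroup (absoluteGaloisGroup ℚ)) [H.Normal] (hH : IsOpen (H : Set (absoluteGaloisGroup ℚ)))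
    (k : ℕ) {S₀ : Set (HeightOneSpectrum (𝓞 ℚ))} (hS₀ : S₀.Finite) :
    {c : subgroupH1 H ↥(AddSubgroup.torsionBy (Cofree ρ (padicCoeffField S)) ((p ^ k : ℕ) : ℤ)) |
      c ∈ GreenbergVatsal2000.unramifiedOutside H
        ↥(AddSubgroup.torsionBy (Cofree ρ (padicCoeffField S)) ((p ^ k : ℕ) : ℤ)) p S₀}.Finite := by
  haveI := UniversalNorms.finite_cofreeTorsionBy_of_compactSpace S ρ k
  haveI := continuousSMul_cofreeTorsionBy S ρ ((p ^ k : ℕ) : ℤ)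
  exact GreenbergVatsal2000.finite_setOf_mem_unramifiedOutside hH (Fact.out : p.Prime).ne_zero hS₀

/-- **FIN_ρ at the layers of a `ℤ_p`-extension** (card k3-g10 `CofreeLayerUnramifiedFinite S ρ κ S₀ m k`, `𝒪` compact):
the Greenberg–Vatsal classes of `H¹(ℚ_m, A_ρ[p^k])` unramified outside `S₀ ∪ {p}` form a finite set
(`κ.layerSubgroup m` is open and normal). [cite: SilvermanAEC2009, Lemma X.4.3] [cite: GreenbergVatsal2000, §2 pp. 16, 23] -/
theorem finite_setOf_mem_unramifiedOutside_cofreeTorsionBy_layer [CompactSpace (padicCoeffIntegers S)]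
    (κ : ZpExtension ℚ p) {S₀ : Set (HeightOneSpectrum (𝓞 ℚ))} (hS₀ : S₀.Finite) (m k : ℕ) :
    {c : subgroupH1 (κ.layerSubgroup m) ↥(AddSubgroup.torsionBy (Cofree ρ (padicCoeffField S)) ((p ^ k : ℕ) : ℤ)) |
      c ∈ GreenbergVatsal2000.unramifiedOutside (κ.layerSubgroup m)
        ↥(AddSubgroup.torsionBy (Cofree ρ (padicCoeffField S)) ((p ^ k : ℕ) : ℤ)) p S₀}.Finite :=
  finite_setOf_mem_unramifiedOutside_cofreeTorsionBy S ρ (κ.layerSubgroup m) (κ.isOpen_layerSubgroup m) k hS₀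

/-- FIN_ρ at the layers, for `𝒪` the valuation ring of a FINITE extension `ℚ_p(S)/ℚ_p`
(`UniversalNorms.compactSpace_padicCoeffIntegers`). [cite: SilvermanAEC2009, Lemma X.4.3] -/
theorem finite_setOf_mem_unramifiedOutside_cofreeTorsionBy_layer_of_finiteDimensional
    [FiniteDimensional ℚ_[p] (padicCoeffField S)]
    (κ : ZpExtension ℚ p) {S₀ : Set (HeightOneSpectrum (𝓞 ℚ))} (hS₀ : S₀.Finite) (m k : ℕ) :
    {c : subgroupH1 (κ.layerSubgroup m) ↥(AddSubgroup.torsionBy (Cofree ρ (padicCoeffField S)) ((p ^ k : ℕ) : ℤ)) |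
      c ∈ GreenbergVatsal2000.unramifiedOutside (κ.layerSubgroup m)
        ↥(AddSubgroup.torsionBy (Cofree ρ (padicCoeffField S)) ((p ^ k : ℕ) : ℤ)) p S₀}.Finite := by
  haveI := UniversalNorms.compactSpace_padicCoeffIntegers S
  exact finite_setOf_mem_unramifiedOutside_cofreeTorsionBy_layer S ρ κ hS₀ m k

end Literature.NumberTheory.EllipticCurves.GreenbergSelmer

end
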